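import Literature.AlgebraicGeometry.Resolution.TeissierPresentation
import HarnessLib

/-!
# Crux `TeissierReduction` (stmt-ResolutionOfSingularities-17085, route `TeissierJung`),
# line `Sketch`: binomial-clean germs are Teissier-presented with `g = 1`

Support lemma for the crux
`Summit.ResolutionOfSingularities.ResolutionOfSingularities.Theses.TeissierJung.TeissierReduction`
(stub `stub_binomialClean` of the line skeleton; idea card `toric-jung-newton-generic`: the
terminal-point lemma of the toric Jung game). Over `Λ = k⟦x₁, …, x_d⟧` the monogenic germ
`Λ[z] ⧸ (z^q − c·x^A·(1 + m))` with `q ≥ 2`, `c ≠ 0`, `m ∈ (x₁, …, x_d)` (`constantCoeff m = 0`)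
and PRIME initial binomial `z^q − c x^A ∈ k[x, z]` carries a Teissier presentation
(`Literature.AlgebraicGeometry.Resolution.TeissierPresentation`, the structural form of
Mourtada–Schober 2025, §3) with ONE step:

  `g = 1`, `n₀ = q`, `v₀ = A / q ∈ ℚ^d`, `c₀ = c`, `A₀ = A`, `μ₀ = 0`, `h₀ = −C(c x^A · m)`.

Homogeneity `q v₀ = A = weight(x^A)` is an identity; the chain condition `n_i v_i < v_{i+1}` is
vacuous for `g = 1`; the tail is overweight because every monomial of `x^A · m` has exponent
`A + b` with `b ≠ 0` (`m` has no constant term), i.e. weight `≥ A`, `≠ A` in the product order;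
the binomial ideal is the given prime ideal `(z^q − c x^A)`; and the single defining equation
`E₀ = core₀ = z^q − c x^A · 1 − c x^A m = z^q − c x^A (1 + m)` generates literally the given
ideal, so the isomorphism `ψ` is `Ideal.quotEquivOfEq`.

* `stub_binomialClean` — the statement above, exactly as registered in the line skeleton.

[folklore]; no definitions, no named facts.
-/

-- single-problem summit: the doubled namespace component is forced
set_option linter.dupNamespace false

noncomputable section

open Literature.AlgebraicGeometry.Resolution

namespace Summit.ResolutionOfSingularities.ResolutionOfSingularities.Theorems.TeissierReduction

/-- Over `Fin 1` the range of a family is the singleton of its value at `0`. [folklore] -/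
private theorem binomialClean_range_fin_one {α : Type*} (f : Fin 1 → α) :
    Set.range f = {f 0} := by
  ext x
  simp only [Set.mem_range, Fin.exists_fin_one, Set.mem_singleton_iff, eq_comm]

/-- The weight identity `q • (A / q) = A` in `ℚ^d` (`q ≠ 0`). [folklore] -/
private theorem binomialClean_nsmul_div {d : ℕ} (q : ℕ) (hq : q ≠ 0) (A : Fin d →₀ ℕ) :
    (q • fun j => (A j : ℚ) / q) = fun j => (A j : ℚ) := by
  have hq0 : (q : ℚ) ≠ 0 := by exact_mod_cast hq
  funext j
  simp only [Pi.smul_apply, nsmul_eq_mul]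
  exact mul_div_cancel₀ _ hq0

/-- A nonzero coefficient of `c x^A · m`, `m` without constant term, sits at an exponent `a ≥ A`,
`a ≠ A`. [folklore] -/
private theorem binomialClean_le_and_ne {k : Type} [Field k] {d : ℕ} (c : k)
    (A a : Fin d →₀ ℕ) (m : MvPowerSeries (Fin d) k) (hm : MvPowerSeries.constantCoeff m = 0)
    (h : MvPowerSeries.coeff a (MvPowerSeries.monomial A c * m) ≠ 0) : A ≤ a ∧ A ≠ a := by
  rw [MvPowerSeries.coeff_monomial_mul] at h
  by_cases hle : A ≤ a
  · refine ⟨hle, fun hAa => h ?_⟩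
    subst hAa
    rw [if_pos le_rfl, tsub_self, MvPowerSeries.coeff_zero_eq_constantCoeff_apply, hm, mul_zero]
  · exact absurd (if_neg hle) h

/-- The product-order comparison `A ≤ a`, `A ≠ a` of exponents, read in `ℚ^d`. [folklore] -/
private theorem binomialClean_cast_le_and_ne {d : ℕ} {A a : Fin d →₀ ℕ} (h : A ≤ a ∧ A ≠ a) :
    ((fun j => (A j : ℚ)) ≤ fun j => (a j : ℚ)) ∧ (fun j => (A j : ℚ)) ≠ fun j => (a j : ℚ) := by
  refine ⟨Pi.le_def.2 fun j => ?_, fun hAa => h.2 (Finsupp.ext fun j => ?_)⟩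
  · exact_mod_cast Finsupp.le_def.1 h.1 j
  · exact Nat.cast_injective (R := ℚ) (congr_fun hAa j)

/-- The one-step Teissier ideal `(E₀)` with `n₀ = q`, `c₀ = c`, `A₀ = A`, `μ₀ = 0`,
`h₀ = −C(c x^A m)` is the principal ideal `(z^q − c x^A (1 + m))`. [folklore] -/
private theorem binomialClean_ideal_eq {k : Type} [Field k] {d : ℕ} (q : ℕ) (c : k)
    (A : Fin d →₀ ℕ) (m : MvPowerSeries (Fin d) k) :
    Teissier.ideal (fun _ : Fin 1 => q) (fun _ => c) (fun _ => A) (fun _ => 0)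
        (fun _ => -MvPolynomial.C (MvPowerSeries.monomial A c * m)) =
      Ideal.span {(MvPolynomial.X 0 ^ q -
        MvPolynomial.C (MvPowerSeries.monomial A c * (1 + m)) :
          MvPolynomial (Fin 1) (MvPowerSeries (Fin d) k))} := by
  rw [Teissier.ideal, binomialClean_range_fin_one]
  have h01 : ¬ ((0 : Fin 1).val + 1 < 1) := by decide
  congr 2
  simp only [Teissier.equation, h01, dite_false, Teissier.core, MvPolynomial.monomial_zero',
    mul_one, map_add, map_mul, map_one]
  ring

/-- The one-step binomial ideal is the given ideal `(z^q − c x^A) ⊂ k[x, z]`. [folklore] -/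
private theorem binomialClean_binomialIdeal_eq {k : Type} [Field k] {d : ℕ} (q : ℕ) (c : k)
    (A : Fin d →₀ ℕ) :
    Teissier.binomialIdeal (k := k) (fun _ : Fin 1 => q) (fun _ => c) (fun _ => A) (fun _ => 0) =
      Ideal.span {(MvPolynomial.X (Sum.inr (0 : Fin 1)) ^ q -
        MvPolynomial.C c * MvPolynomial.monomial (A.sumElim (0 : Fin 1 →₀ ℕ)) 1 :
          MvPolynomial (Fin d ⊕ Fin 1) k)} := by
  rw [Teissier.binomialIdeal, binomialClean_range_fin_one]
  rfl

/-- **Binomial-clean germs are Teissier-presented** (stub `stub_binomialClean` of line `Sketch`,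
card `toric-jung-newton-generic`, terminal-point lemma). Over `Λ = k⟦x₁,…,x_d⟧`, the monogenic
order `Λ[z]/(z^q − c·x^A·(1 + m))` with `q ≥ 2`, `c ≠ 0`, `m ∈ (x)` and PRIME initial binomial
`z^q − c x^A` carries a Teissier presentation with `g = 1`, weight `v₀ = A/q`, tail
`h₀ := −c·x^A·m` (every monomial of `x^A m` has exponent `A + b`, `b ≠ 0`, i.e. weight
`> A = q v₀` in the product order); the presenting ideal is literally `(z^q − c x^A (1 + m))`,
and `ψ = Ideal.quotEquivOfEq`. [folklore] -/
theorem stub_binomialClean {k : Type} [Field k] {d : ℕ} (q : ℕ) (hq : 2 ≤ q)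
    (c : k) (hc : c ≠ 0) (A : Fin d →₀ ℕ) (m : MvPowerSeries (Fin d) k)
    (hm : MvPowerSeries.constantCoeff m = 0)
    (hprime : (Ideal.span {(MvPolynomial.X (Sum.inr (0 : Fin 1)) ^ q -
        MvPolynomial.C c * MvPolynomial.monomial (A.sumElim (0 : Fin 1 →₀ ℕ)) 1 :
          MvPolynomial (Fin d ⊕ Fin 1) k)}).IsPrime) :
    TeissierPresentation k d
      (MvPolynomial (Fin 1) (MvPowerSeries (Fin d) k) ⧸
        Ideal.span {(MvPolynomial.X 0 ^ q -
          MvPolynomial.C (MvPowerSeries.monomial A c * (1 + m)) :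
            MvPolynomial (Fin 1) (MvPowerSeries (Fin d) k))})
      ((Ideal.Quotient.mk _).comp MvPolynomial.C) := by
  have hw := binomialClean_nsmul_div q (by omega) A
  refine ⟨1, fun _ => q, fun _ j => (A j : ℚ) / q, fun _ => c, fun _ => A, fun _ => 0,
    fun _ => -MvPolynomial.C (MvPowerSeries.monomial A c * m),
    ⟨fun _ => hq, fun _ => hc, fun _ j => div_nonneg (Nat.cast_nonneg _) (Nat.cast_nonneg _),
      fun _ _ _ => rfl, fun i => ?_, fun i hi => absurd hi (by omega), fun i e he => ?_, ?_⟩,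
    Ideal.quotEquivOfEq (binomialClean_ideal_eq q c A m).symm, fun a => rfl⟩
  · -- homogeneity: `q • (A / q) = A = weight (x^A)`
    simp only [Teissier.weight_zero_right]
    exact hw
  · -- overweight tail: `h₀ = −C(c x^A m)` is a constant of `Λ[z]`, its `x`-monomials exceed `A`
    classical
    simp only [MvPolynomial.mem_support_iff, MvPolynomial.coeff_neg, MvPolynomial.coeff_C,
      ne_eq, neg_eq_zero, ite_eq_right_iff, Classical.not_imp] at he
    obtain ⟨he0, -⟩ := he
    subst he0
    refine ⟨fun j hj => absurd hj (by omega), fun a ha => ?_⟩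
    simp only [MvPolynomial.coeff_neg, MvPolynomial.coeff_zero_C, map_neg, ne_eq,
      neg_eq_zero] at ha
    simp only [Teissier.weight_zero_right, hw]
    exact binomialClean_cast_le_and_ne (binomialClean_le_and_ne c A a m hm ha)
  · -- the binomial ideal is the given prime `(z^q − c x^A)`
    rw [binomialClean_binomialIdeal_eq]
    exact hprime

end Summit.ResolutionOfSingularities.ResolutionOfSingularities.Theorems.TeissierReduction

end
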